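import Literature.Probability.LatticeModels.GriffithsMonotonicity
import Literature.Probability.LatticeModels.GKSInequalities
import Literature.Probability.LatticeModels.DirInvCorrLength
import Literature.Probability.LatticeModels.PlusFreeComparison

/-! # Finite energy of free correlations under deletion of edges
(line `screening-form-lemma-a1` of crux `GapForcesFarMerging`, item stmt-CriticalPhenomena-4468;
helper file of stub `stub_rootOpacity`, ROOT FINITE ENERGY, general finite-graph part)

For graphs `G₁ ≤ G₂` on one vertex set, a finite volume `Λ`, the free boundary condition, `β ≥ 0`,
`h = 0` and `A ⊆ Λ`, write `D = ℰ_Λ(G₂) ∖ ℰ_Λ(G₁)` (the deleted edges) and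
`W = ∏_{e ∈ D} e^{βσ_e} = ∑_{S ⊆ D} cosh(β)^{|D∖S|} sinh(β)^{|S|} σ_{∂S}`, `∂S` the set of odd-degree
vertices of `S` (`Finset.fold (· ∆ ·)` of the endpoint pairs). The tilt identity
`⟨σ_A⟩_{G₂}⟨W⟩_{G₁} = ⟨σ_A W⟩_{G₁}` (`isingExpect_free_mul_of_le`) gives the FINITE ENERGY COMPARISON
`⟨σ_A⟩_{G₂} ≤ M e^{2β|D|} ⟨σ_A⟩_{G₁}` as soon as every `⟨σ_{A ∆ ∂S}⟩_{G₁} ≤ M ⟨σ_A⟩_{G₁}`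
(`isingCorr_free_le_of_deleted`). The two tools for verifying the hypothesis are recorded here:
`∂S` has even cardinality (`even_card_fold_symmDiff`), and a correlation containing a vertex of `Λ`
isolated in `ℰ_Λ(G₁)` vanishes by the one-site spin flip (`isingCorr_free_eq_zero_of_isolated`); the
remaining case is GKS II, `⟨σ_{A∆∂S}⟩⟨σ_{∂S}⟩ ≤ ⟨σ_A⟩`, with a local lower bound on `⟨σ_{∂S}⟩`,
for which the GKS chain `⟨σ_aσ_b⟩⟨σ_bσ_c⟩ ≤ ⟨σ_aσ_c⟩` and positivity along a chain of adjacent sites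
(`isingCorr_pos_of_adj_chain`) are provided. References: Friedli–Velenik 2017, §3.7.1 (spin flip), Exercise 3.31 (couplings as tilts), Thm. 3.20
(GKS); Burton–Keane 1989 (finite energy). -/

noncomputable section

namespace Summit.CriticalPhenomena.Ising3DConformalLimit.EnergyNotSigmaSquaredGapForcesFarMerging

open scoped symmDiff
open MeasureTheory Finset
open Literature.Probability.LatticeModels

variable {V : Type*} [DecidableEq V]

/-! ### Parity of the boundary of an edge set -/

/-- `|s ∆ t| + 2|s ∩ t| = |s| + |t|`. [folklore] -/
theorem card_symmDiff_add_two_mul (s t : Finset V) : #(s ∆ t) + 2 * #(s ∩ t) = #s + #t := by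
  rw [symmDiff_def, Finset.sup_eq_union, Finset.card_union_of_disjoint disjoint_sdiff_sdiff,
    ← Finset.card_sdiff_add_card_inter s t, ← Finset.card_sdiff_add_card_inter t s, Finset.inter_comm t s]
  ring

/-- The boundary `∂S` (iterated symmetric difference of the endpoint pairs) of a finite set of
non-diagonal pairs has even cardinality (handshake). [folklore] -/
theorem even_card_fold_symmDiff (F : Finset (Sym2 V)) (hF : ∀ e ∈ F, ¬e.IsDiag) :
    Even #(F.fold (fun s t : Finset V => s ∆ t) (∅ : Finset V) Sym2.toFinset) := by
  induction F using Finset.induction_on with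
  | empty => simp
  | insert e F heF ih =>
    rw [Finset.fold_insert heF]
    have h2 : #(e.toFinset) = 2 := Sym2.card_toFinset_of_not_isDiag e (hF e (mem_insert_self e F))
    have hadd := card_symmDiff_add_two_mul e.toFinset (F.fold (fun s t : Finset V => s ∆ t) ∅ Sym2.toFinset)
    obtain ⟨k, hk⟩ := ih fun e' he' => hF e' (mem_insert_of_mem he')
    refine ⟨1 + k - #(e.toFinset ∩ F.fold (fun s t : Finset V => s ∆ t) ∅ Sym2.toFinset), ?_⟩
    omega

/-! ### One-site spin flip: correlations through an isolated vertex vanish -/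

section Flip

variable (G : SimpleGraph V) [G.LocallyFinite]

/-- Flipping the inside configuration at one site `q ∈ Λ`. [folklore] -/
theorem spinAt_glue_update_neg {Λ : Finset V} (τ : Λ → ℤˣ) (q : Λ) (x : V) :
    spinAt x (glue Λ (Function.update τ q (-τ q)) .free) =
      if x = q then -spinAt x (glue Λ τ .free) else spinAt x (glue Λ τ .free) := by
  by_cases hx : x = q
  · subst hx
    rw [if_pos rfl, spinAt, spinAt, glue_apply_of_mem Λ _ _ q.2, glue_apply_of_mem Λ _ _ q.2]
    simp
  · rw [if_neg hx]
    by_cases hxΛ : x ∈ Λ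
    · rw [spinAt, spinAt, glue_apply_of_mem Λ _ _ hxΛ, glue_apply_of_mem Λ _ _ hxΛ,
        Function.update_of_ne (fun h => hx (congrArg Subtype.val h))]
    · simp [spinAt, glue, hxΛ]

/-- The one-site flip reverses the sign of a spin product through that site. [folklore] -/
theorem spinProduct_glue_update_neg {Λ B : Finset V} (τ : Λ → ℤˣ) (q : Λ) (hqB : (q : V) ∈ B) :
    spinProduct B (glue Λ (Function.update τ q (-τ q)) .free) = -spinProduct B (glue Λ τ .free) := by
  rw [spinProduct, spinProduct, ← Finset.mul_prod_erase B _ hqB, ← Finset.mul_prod_erase B _ hqB,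
    spinAt_glue_update_neg, if_pos rfl, neg_mul]
  congr 2
  exact Finset.prod_congr rfl fun x hx => by
    rw [spinAt_glue_update_neg, if_neg (Finset.ne_of_mem_erase hx)]

/-- The free zero-field weight is invariant under the flip at a site meeting no interaction edge. [folklore] -/
theorem isingWeight_free_update_neg {Λ : Finset V} (τ : Λ → ℤˣ) (q : Λ)
    (hiso : ∀ e ∈ edgesIn G Λ, (q : V) ∉ e) (β : ℝ) :
    isingWeight G Λ β 0 .free (Function.update τ q (-τ q)) = isingWeight G Λ β 0 .free τ := by
  simp only [isingWeight, isingHamiltonian, interactionEdges_free, zero_mul, sub_zero]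
  congr 3
  refine Finset.sum_congr rfl fun e he => ?_
  have hq := hiso e he
  induction e using Sym2.ind with
  | _ u v =>
    rw [bondSpin_mk, bondSpin_mk, spinAt_glue_update_neg, spinAt_glue_update_neg,
      if_neg (fun h => hq (by rw [← h]; exact Sym2.mem_mk_left u v)),
      if_neg (fun h => hq (by rw [← h]; exact Sym2.mem_mk_right u v))]

/-- **Correlations through an isolated vertex vanish**: for the free boundary condition at zero field,
if `q ∈ Λ` meets no edge of `ℰ_Λ(G)` and `q ∈ B`, then `⟨σ_B⟩^∅_{Λ;β,0} = 0` (the flip of the spin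
at `q` preserves the weights and reverses `σ_B`). [cite: FriedliVelenik2017, §3.7.1, eq. (3.33)] -/
theorem isingCorr_free_eq_zero_of_isolated {Λ B : Finset V} {q : V} (hq : q ∈ Λ) (hqB : q ∈ B)
    (hiso : ∀ e ∈ edgesIn G Λ, q ∉ e) (β : ℝ) : isingCorr G Λ β 0 .free B = 0 := by
  rw [isingCorr, isingExpect_eq_sum_div G Λ 0 .free β (measurable_spinProduct B)]
  set φ : (Λ → ℤˣ) → (Λ → ℤˣ) := fun τ => Function.update τ ⟨q, hq⟩ (-τ ⟨q, hq⟩) with hφ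
  have hφφ : Function.Involutive φ := fun τ => by
    simp only [hφ]
    rw [Function.update_idem, Function.update_self, neg_neg, Function.update_eq_self]
  set S := ∑ τ : Λ → ℤˣ, isingWeight G Λ β 0 .free τ * spinProduct B (glue Λ τ .free) with hS
  have h1 : S = ∑ τ : Λ → ℤˣ, isingWeight G Λ β 0 .free (φ τ) * spinProduct B (glue Λ (φ τ) .free) :=
    (Fintype.sum_bijective φ hφφ.bijective _ _ fun _ => rfl).symm
  have h2 : ∑ τ : Λ → ℤˣ, isingWeight G Λ β 0 .free (φ τ) * spinProduct B (glue Λ (φ τ) .free) = -S := by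
    rw [hS, ← Finset.sum_neg_distrib]
    refine Finset.sum_congr rfl fun τ _ => ?_
    rw [isingWeight_free_update_neg G τ ⟨q, hq⟩ hiso, spinProduct_glue_update_neg τ ⟨q, hq⟩ hqB]
    ring
  have hS0 : S = 0 := by linarith
  rw [hS0, zero_div]

end Flip

/-! ### The finite energy comparison -/

section FiniteEnergy

/-- A positive lower bound on a free expectation from a pointwise lower bound. [folklore] -/
theorem le_isingExpect_of_forall_le (G : SimpleGraph V) [G.LocallyFinite] (Λ : Finset V) (β h : ℝ)
    {f : SpinConfig V → ℝ} (hf : Measurable f) {c : ℝ} (hc : ∀ σ, c ≤ f σ) :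
    c ≤ isingExpect G Λ β h .free f := by
  rw [isingExpect_eq_sum_div G Λ h .free β hf, le_div_iff₀ (isingPartitionFunction_pos G Λ β h .free),
    isingPartitionFunction, Finset.mul_sum]
  exact Finset.sum_le_sum fun τ _ => by
    rw [mul_comm]; exact mul_le_mul_of_nonneg_left (hc _) (isingWeight_pos G Λ β h .free τ).le

/-- **Finite energy of free correlations under deletion of edges.** For graphs `G₁ ≤ G₂`, the free
boundary condition at zero field, `β ≥ 0`, `A ⊆ Λ`, `D = ℰ_Λ(G₂) ∖ ℰ_Λ(G₁)`: if
`⟨σ_{A ∆ ∂S}⟩_{G₁} ≤ M⟨σ_A⟩_{G₁}` for every `S ⊆ D`, then `⟨σ_A⟩_{G₂} ≤ M e^{2β|D|} ⟨σ_A⟩_{G₁}`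
(tilt `⟨σ_A⟩_{G₂}⟨W⟩_{G₁} = ⟨σ_A W⟩_{G₁}`, `W = ∏_{e∈D} e^{βσ_e} ≥ e^{-β|D|}`, expanded with
`∑_{S} cosh^{|D∖S|} sinh^{|S|} = e^{β|D|}`). [cite: FriedliVelenik2017, Exercise 3.31] -/
theorem isingCorr_free_le_of_deleted {G₁ G₂ : SimpleGraph V} [G₁.LocallyFinite] [G₂.LocallyFinite]
    (hle : G₁ ≤ G₂) {Λ A : Finset V} {β M : ℝ} (hβ : 0 ≤ β) (hA : A ⊆ Λ)
    (hbound : ∀ S ⊆ edgesIn G₂ Λ \ edgesIn G₁ Λ,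
      isingCorr G₁ Λ β 0 .free (A ∆ S.fold (fun s t : Finset V => s ∆ t) ∅ Sym2.toFinset) ≤
        M * isingCorr G₁ Λ β 0 .free A) :
    isingCorr G₂ Λ β 0 .free A ≤
      M * Real.exp (2 * β * #(edgesIn G₂ Λ \ edgesIn G₁ Λ)) * isingCorr G₁ Λ β 0 .free A := by
  set D := edgesIn G₂ Λ \ edgesIn G₁ Λ with hD
  have hDprop : ∀ e ∈ D, ¬e.IsDiag := fun e he =>
    SimpleGraph.not_isDiag_of_mem_edgeSet _ (mem_edgesIn_iff.1 (Finset.mem_sdiff.1 he).1).1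
  -- the tilt `W` and its expansion into spin products
  set W : SpinConfig V → ℝ := fun σ => ∏ e ∈ D, Real.exp (β * bondSpin σ e) with hW
  have hWexp : W = fun σ => ∑ t ∈ D.powerset,
      (Real.cosh β ^ #t * Real.sinh β ^ #(D \ t)) *
        spinProduct ((D \ t).fold (fun s t : Finset V => s ∆ t) (∅ : Finset V) Sym2.toFinset) σ := by
    funext σ
    simp only [hW, exp_mul_bondSpin]
    rw [Finset.prod_add]
    refine Finset.sum_congr rfl fun t ht => ?_
    rw [Finset.prod_const, Finset.prod_mul_distrib, Finset.prod_const,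
      prod_bondSpin_eq_spinProduct_fold _ fun e he => hDprop e (Finset.mem_sdiff.1 he).1]
    ring
  have hWm : Measurable W :=
    Finset.measurable_prod _ fun e _ => Real.measurable_exp.comp ((measurable_bondSpin e).const_mul β)
  -- `⟨W⟩₁ ≥ e^{-β|D|}`
  have hWlow : Real.exp (-(β * #D)) ≤ isingExpect G₁ Λ β 0 .free W := by
    refine le_isingExpect_of_forall_le G₁ Λ β 0 hWm fun σ => ?_
    simp only [hW]
    rw [show -(β * #D) = ∑ _e ∈ D, -β by rw [sum_const, nsmul_eq_mul]; ring, Real.exp_sum]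
    refine Finset.prod_le_prod (fun e _ => (Real.exp_pos _).le) fun e _ => Real.exp_le_exp.2 ?_
    rcases bondSpin_eq_one_or σ e with h1 | h1 <;> rw [h1] <;> nlinarith
  have hWpos : 0 < isingExpect G₁ Λ β 0 .free W := lt_of_lt_of_le (Real.exp_pos _) hWlow
  -- `⟨σ_A W⟩₁ ≤ M e^{β|D|} ⟨σ_A⟩₁`
  have hmeas : ∀ t : Finset (Sym2 V), Measurable fun σ : SpinConfig V =>
      (Real.cosh β ^ #t * Real.sinh β ^ #(D \ t)) *
        spinProduct (A ∆ (D \ t).fold (fun s t : Finset V => s ∆ t) (∅ : Finset V) Sym2.toFinset) σ :=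
    fun t => (measurable_spinProduct _).const_mul _
  have hup : isingExpect G₁ Λ β 0 .free (fun σ => spinProduct A σ * W σ) ≤
      M * Real.exp (β * #D) * isingCorr G₁ Λ β 0 .free A := by
    have hfun : (fun σ => spinProduct A σ * W σ) = fun σ => ∑ t ∈ D.powerset,
        (Real.cosh β ^ #t * Real.sinh β ^ #(D \ t)) *
          spinProduct (A ∆ (D \ t).fold (fun s t : Finset V => s ∆ t) (∅ : Finset V) Sym2.toFinset) σ := by
      funext σ
      rw [hWexp, Finset.mul_sum]
      exact Finset.sum_congr rfl fun t _ => by rw [← spinProduct_mul_spinProduct]; ring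
    rw [hfun, isingExpect_finset_sum' G₁ Λ 0 .free β D.powerset _ hmeas]
    calc ∑ t ∈ D.powerset, isingExpect G₁ Λ β 0 .free (fun σ =>
          (Real.cosh β ^ #t * Real.sinh β ^ #(D \ t)) *
            spinProduct (A ∆ (D \ t).fold (fun s t : Finset V => s ∆ t) (∅ : Finset V) Sym2.toFinset) σ)
        = ∑ t ∈ D.powerset, (Real.cosh β ^ #t * Real.sinh β ^ #(D \ t)) *
            isingCorr G₁ Λ β 0 .free
              (A ∆ (D \ t).fold (fun s t : Finset V => s ∆ t) (∅ : Finset V) Sym2.toFinset) :=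
          Finset.sum_congr rfl fun t _ => isingExpect_const_mul' G₁ Λ 0 .free β _ (measurable_spinProduct _)
      _ ≤ ∑ t ∈ D.powerset, (Real.cosh β ^ #t * Real.sinh β ^ #(D \ t)) *
            (M * isingCorr G₁ Λ β 0 .free A) :=
          Finset.sum_le_sum fun t _ => mul_le_mul_of_nonneg_left
            (hbound (D \ t) Finset.sdiff_subset)
            (mul_nonneg (pow_nonneg (Real.cosh_pos β).le _) (pow_nonneg (Real.sinh_nonneg_iff.2 hβ) _))
      _ = (∏ _e ∈ D, (Real.cosh β + Real.sinh β)) * (M * isingCorr G₁ Λ β 0 .free A) := by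
          rw [← Finset.sum_mul, Finset.prod_add]
          congr 1
          exact Finset.sum_congr rfl fun t _ => by rw [Finset.prod_const, Finset.prod_const]
      _ = M * Real.exp (β * #D) * isingCorr G₁ Λ β 0 .free A := by
          rw [Real.cosh_add_sinh, Finset.prod_const, ← Real.exp_nat_mul]; ring_nf
  -- assemble
  have hkey := isingExpect_free_mul_of_le hle Λ β 0 (measurable_spinProduct A)
  change isingCorr G₂ Λ β 0 .free A * isingExpect G₁ Λ β 0 .free W =
    isingExpect G₁ Λ β 0 .free (fun σ => spinProduct A σ * W σ) at hkey
  have hA1 : 0 ≤ isingCorr G₁ Λ β 0 .free A := GKSInequalities.gks_one_holds G₁ hβ le_rfl (Or.inl rfl) hA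
  have hM : 0 ≤ M * Real.exp (β * #D) * isingCorr G₁ Λ β 0 .free A := by
    by_cases hA0 : isingCorr G₁ Λ β 0 .free A = 0
    · rw [hA0, mul_zero]
    · have hpos : 0 < isingCorr G₁ Λ β 0 .free A := lt_of_le_of_ne hA1 (Ne.symm hA0)
      have h0 := hbound ∅ (Finset.empty_subset _)
      rw [Finset.fold_empty, show A ∆ (∅ : Finset V) = A from symmDiff_bot A] at h0
      have hM0 : 0 ≤ M := by
        by_contra hM0
        push Not at hM0
        have := mul_neg_of_neg_of_pos hM0 hpos
        linarith
      positivity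
  have h1 : isingCorr G₂ Λ β 0 .free A * isingExpect G₁ Λ β 0 .free W ≤
      M * Real.exp (β * #D) * isingCorr G₁ Λ β 0 .free A := hkey ▸ hup
  have h2 : isingCorr G₂ Λ β 0 .free A ≤
      M * Real.exp (β * #D) * isingCorr G₁ Λ β 0 .free A / isingExpect G₁ Λ β 0 .free W :=
    (le_div_iff₀ hWpos).2 h1
  refine h2.trans ?_
  rw [div_le_iff₀ hWpos]
  calc M * Real.exp (β * #D) * isingCorr G₁ Λ β 0 .free A
      = M * Real.exp (2 * β * #D) * isingCorr G₁ Λ β 0 .free A * Real.exp (-(β * #D)) := by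
        rw [show (2 : ℝ) * β * #D = β * #D + β * #D by ring, Real.exp_add, Real.exp_neg]
        field_simp
    _ ≤ M * Real.exp (2 * β * #D) * isingCorr G₁ Λ β 0 .free A * isingExpect G₁ Λ β 0 .free W := by
        refine mul_le_mul_of_nonneg_left hWlow ?_
        have : 0 ≤ M * Real.exp (β * #D) * isingCorr G₁ Λ β 0 .free A * Real.exp (β * #D) :=
          mul_nonneg hM (Real.exp_pos _).le
        calc (0 : ℝ) ≤ M * Real.exp (β * #D) * isingCorr G₁ Λ β 0 .free A * Real.exp (β * #D) := this
          _ = M * Real.exp (2 * β * #D) * isingCorr G₁ Λ β 0 .free A := by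
            rw [show (2 : ℝ) * β * #D = β * #D + β * #D by ring, Real.exp_add]; ring

end FiniteEnergy

/-! ### GKS chains and positivity along chains of adjacent sites -/

section Chains

variable (G : SimpleGraph V) [G.LocallyFinite]

/-- **GKS II chain for pairs**: `⟨σ_{{a}∆{b}}⟩⟨σ_{{b}∆{c}}⟩ ≤ ⟨σ_{{a}∆{c}}⟩` (free, `β ≥ 0`, `h = 0`,
`a, b, c ∈ Λ`). [cite: FriedliVelenik2017, Thm. 3.20] -/
theorem isingCorr_pair_chain {Λ : Finset V} {a b c : V} (ha : a ∈ Λ) (hb : b ∈ Λ) (hc : c ∈ Λ)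
    {β : ℝ} (hβ : 0 ≤ β) :
    isingCorr G Λ β 0 .free ({a} ∆ {b}) * isingCorr G Λ β 0 .free ({b} ∆ {c}) ≤
      isingCorr G Λ β 0 .free ({a} ∆ {c}) := by
  have hsub : ∀ {u w : V}, u ∈ Λ → w ∈ Λ → ({u} ∆ {w} : Finset V) ⊆ Λ := fun hu hw x hx => by
    rcases Finset.mem_symmDiff.1 hx with ⟨h, -⟩ | ⟨h, -⟩
    · rw [Finset.mem_singleton.1 h]; exact hu
    · rw [Finset.mem_singleton.1 h]; exact hw
  have h := GKSInequalities.gks_two_holds G hβ le_rfl (Or.inl rfl) (hsub ha hb) (hsub hb hc)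
  rwa [symmDiff_assoc, symmDiff_symmDiff_cancel_left] at h

/-- **Positivity along a chain of adjacent sites**: for `β > 0` and sites `x 0 ∼ x 1 ∼ ⋯ ∼ x k` of `Λ`,
`⟨σ_{{x 0} ∆ {x k}}⟩^∅_{Λ;β,0} > 0` (nearest-neighbour positivity `isingCorr_pair_pos_of_adj` chained
by GKS II). [cite: FriedliVelenik2017, §3.8.1, p. 141] -/
theorem isingCorr_pos_of_adj_chain {Λ : Finset V} {β : ℝ} (hβ : 0 < β) (x : ℕ → V) (k : ℕ)
    (hmem : ∀ t ≤ k, x t ∈ Λ) (hadj : ∀ t < k, G.Adj (x t) (x (t + 1))) :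
    0 < isingCorr G Λ β 0 .free ({x 0} ∆ {x k}) := by
  induction k with
  | zero => rw [symmDiff_self, Finset.bot_eq_empty, isingCorr_empty]; exact one_pos
  | succ k ih =>
    have ih' := ih (fun t ht => hmem t (Nat.le_succ_of_le ht)) fun t ht => hadj t (Nat.lt_succ_of_lt ht)
    have hk := hadj k (Nat.lt_succ_self k)
    have hedge : 0 < isingCorr G Λ β 0 .free ({x k} ∆ {x (k + 1)}) := by
      have h := isingCorr_pair_pos_of_adj G hk (hmem k (Nat.le_succ k)) (hmem (k + 1) le_rfl) hβ le_rfl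
        (bc := .free) (Or.inl rfl)
      have hne : x k ≠ x (k + 1) := hk.ne
      rwa [show ({x k} ∆ {x (k + 1)} : Finset V) = {x k, x (k + 1)} by
        ext y; simp [Finset.mem_symmDiff, Finset.mem_insert]; constructor
        · rintro (⟨h, -⟩ | ⟨h, -⟩) <;> simp [h]
        · rintro (h | h) <;> subst h <;> simp [hne, Ne.symm hne]]
    exact lt_of_lt_of_le (mul_pos ih' hedge)
      (isingCorr_pair_chain G (hmem 0 (Nat.zero_le _)) (hmem k (Nat.le_succ k)) (hmem (k + 1) le_rfl) hβ.le)

/-- **Positivity of even correlations from pair positivity**: if `⟨σ_{{a}∆{b}}⟩^∅_{Λ;β,0} > 0` for all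
`a, b ∈ P ⊆ Λ` (`β ≥ 0`), then `⟨σ_B⟩^∅_{Λ;β,0} > 0` for every `B ⊆ P` of even cardinality (pair off two
points of `B` by GKS II and recurse). [cite: FriedliVelenik2017, Thm. 3.20] -/
theorem isingCorr_pos_of_even {Λ P : Finset V} (hP : P ⊆ Λ) {β : ℝ} (hβ : 0 ≤ β)
    (hpair : ∀ a ∈ P, ∀ b ∈ P, 0 < isingCorr G Λ β 0 .free ({a} ∆ {b})) :
    ∀ B ⊆ P, Even #B → 0 < isingCorr G Λ β 0 .free B := by
  intro B
  induction B using Finset.strongInduction with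
  | H B ih =>
    intro hBP heven
    rcases B.eq_empty_or_nonempty with rfl | ⟨a, ha⟩
    · rw [isingCorr_empty]; exact one_pos
    · have h2 : 1 < #B := by
        have h1 : 1 ≤ #B := Finset.card_pos.2 ⟨a, ha⟩
        obtain ⟨k, hk⟩ := heven
        omega
      obtain ⟨b, hb, hba⟩ := Finset.exists_mem_ne h2 a
      have hsub : ({a} ∆ {b} : Finset V) ⊆ B := fun x hx => by
        rcases Finset.mem_symmDiff.1 hx with ⟨h, -⟩ | ⟨h, -⟩
        · rw [Finset.mem_singleton.1 h]; exact ha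
        · rw [Finset.mem_singleton.1 h]; exact hb
      have hcard2 : #({a} ∆ {b} : Finset V) = 2 := by
        rw [show ({a} ∆ {b} : Finset V) = {a, b} by
          ext y; simp [Finset.mem_symmDiff]; constructor
          · rintro (⟨h, -⟩ | ⟨h, -⟩) <;> simp [h]
          · rintro (h | h) <;> subst h <;> simp [hba, Ne.symm hba]]
        exact Finset.card_pair (Ne.symm hba)
      set B' := B ∆ ({a} ∆ {b}) with hB'
      have hB'eq : B' = B \ ({a} ∆ {b}) := by
        rw [hB', symmDiff_def, Finset.sup_eq_union, Finset.sdiff_eq_empty_iff_subset.2 hsub,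
          Finset.union_empty]
      have hB'ss : B' ⊂ B := by
        rw [hB'eq]
        exact Finset.sdiff_ssubset hsub ⟨a, Finset.mem_symmDiff.2 (Or.inl ⟨Finset.mem_singleton_self a,
          fun h => hba (Finset.mem_singleton.1 h).symm⟩)⟩
      have hB'even : Even #B' := by
        rw [hB'eq, Finset.card_sdiff_of_subset hsub, hcard2]
        obtain ⟨k, hk⟩ := heven
        exact ⟨k - 1, by omega⟩
      have hpos' := ih B' hB'ss (hB'ss.subset.trans hBP) hB'even
      have hgks := GKSInequalities.gks_two_holds G hβ le_rfl (Or.inl rfl) ((hB'ss.subset.trans hBP).trans hP)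
        ((hsub.trans hBP).trans hP) (A := B') (B := {a} ∆ {b})
      rw [hB', symmDiff_assoc, symmDiff_self, symmDiff_bot] at hgks
      exact lt_of_lt_of_le (mul_pos hpos' (hpair a (hBP ha) b (hBP hb))) hgks

end Chains

/-- **Finite energy of free correlations under deletion of edges** (registered form of
`isingCorr_free_le_of_deleted`, vertex types in `Type`). [cite: FriedliVelenik2017, Exercise 3.31] -/
theorem finiteEnergy_deleted_edges : ∀ {W : Type} [DecidableEq W] {G₁ G₂ : SimpleGraph W} [G₁.LocallyFinite] [G₂.LocallyFinite], G₁ ≤ G₂ → ∀ {Λ A : Finset W} {β M : ℝ}, 0 ≤ β → A ⊆ Λ → (∀ S ⊆ edgesIn G₂ Λ \ edgesIn G₁ Λ, isingCorr G₁ Λ β 0 .free (A ∆ S.fold (fun s t : Finset W => s ∆ t) ∅ Sym2.toFinset) ≤ M * isingCorr G₁ Λ β 0 .free A) → isingCorr G₂ Λ β 0 .free A ≤ M * Real.exp (2 * β * #(edgesIn G₂ Λ \ edgesIn G₁ Λ)) * isingCorr G₁ Λ β 0 .free A :=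
  fun hle _ _ _ _ hβ hA hb => isingCorr_free_le_of_deleted hle hβ hA hb

end Summit.CriticalPhenomena.Ising3DConformalLimit.EnergyNotSigmaSquaredGapForcesFarMerging

end
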